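import Summits.ABC.IUTFork.LDHSplitBadPrimeThreshold
import Summits.ABC.IUTFork.LDHSplitBadPrimeLargeL
import Summits.ABC.IUTFork.LDHSplitBadPrimeRational
import HarnessLib

/-!
# The fork at [IUTchIII] Corollary 3.12, L-DH level: the large-`l` PHASE DIAGRAM of the one-bad-place family — `Pr(v₀) = 1`: FALSE
# deep for EVERY `l`; `Pr(v₀) < 1`: TRUE at every depth for all LARGE `l`

Proof-only companion (D-0012; 0 definitions, no `Prop` fact) of `LDHSplitBadPrimeThreshold.lean` (p432280), `LDHSplitBadPrimeLargeL.lean`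
(p430596) and `LDHSplitBadPrimeRational.lean` (p430803), abc-iut-w5-d018 (gen 4). TAKES NO SIDE on [IUTchIII] Cor. 3.12.

Along abc-iut-c312-3's synthetic one-bad-place family `deepAtPlace p v₀ l N σ` the typed `Cor312Of` is decided by the sign of
`c(Pr(v₀)) − 1`, `c(β) = (1/ℓ⋇)Σ_{i<ℓ⋇}(i+1)²β^{i+1}` (`deepAtPlace_threshold`). Since `c(1) = (ℓ⋇+1)(2ℓ⋇+1)/6 > 1` for every `ℓ⋇ ≥ 2`
while `c(β) → 0` as `ℓ⋇ → ∞` for each fixed `β < 1`: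

* **`exists_deepAtPlace_not_cor312Of_of_weight_eq_one`** — if `v₀` carries ALL of the degree over `p` (`Pr(v₀) = 1`: the only place
  over `p`; always the case over `F₀ = ℚ`), then for EVERY prime `l ≥ 5`, every `K ⊇ F₀`, `σ`: `¬ Cor312Of (deepAtPlace p v₀ l N σ)` at
  SOME depth `N` (abc-iut-w5-d157's FALSE side, recovered through the threshold);
* **`exists_lstar_bound_cor312Of_deepAtPlace_of_weight_lt_one`** — if `Pr(v₀) < 1` (at least two places over `p`), there is `L` such
  that for EVERY prime `l ≥ 5` with `ℓ⋇ = (l−1)/2 ≥ L`, every `σ` and EVERY depth `N`: `Cor312NonarchOf ∧ Cor312Of` for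
  `deepAtPlace p v₀ l N σ`;
* `deepAtPlace_phase` — both packaged: the large-`l` phase of the family at `v₀` is FALSE-deep iff `Pr(v₀) = 1`, TRUE-always iff
  `Pr(v₀) < 1`.

READING (neutral): initial Θ-data want `l` LARGE ([IUTchIV] Cor. 2.2); in that regime the sharp Dupuy–Hilado-level model's typed
inequality along one-bad-place synthetic families FAILS deep exactly at places that are ALONE over their prime — every place of `ℚ`,
inert or totally ramified primes of any `F₀` — and HOLDS at every depth at every other place. Synthetic inputs, typed objects ((Ind1) = all
capsule-index permutations, R2); no side taken; typed ≠ proved. [cite: DupuyHilado2025, §1 (1.1), §3.6, §4.7]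
[cite: Mochizuki2012, IUTchIV Cor. 2.2] [cite: Mochizuki2012, IUTchIII Cor. 3.12 p. 173–174] [claim: Mochizuki2012, status: disputed]
-/

noncomputable section

open Finset NumberField IsDedekindDomain Literature.IUT.LogVolume

namespace Summit.ABC.IUTFork

variable {F₀ : Type} [Field F₀] [NumberField F₀] {K : Type} [Field K] [NumberField K] [Algebra F₀ K]
variable (p : ℕ) [hp : Fact p.Prime] (v₀ : placesOver F₀ p)

/-- `ℓ⋇ = (l−1)/2 ≥ 2` for a prime `l ≥ 5`. [folklore] -/
theorem two_le_half_pred_of_five_le {l : ℕ} (h5 : 5 ≤ l) : 2 ≤ (l - 1) / 2 := by omega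

/-- **`Pr(v₀) = 1` ⇒ FALSE deep, for EVERY `l`**: if `v₀` is alone over `p` (`n_{v₀} = [F₀:ℚ]`), then for every prime `l ≥ 5`, every
`K ⊇ F₀` and section `σ`, some depth `N` has `¬ Cor312Of (deepAtPlace p v₀ l N σ)` (`c(1) = (1/ℓ⋇)Σ(i+1)² > 1`,
`deepAtPlace_threshold`). Synthetic input; typed objects; no side taken. [claim: Mochizuki2012, status: disputed]
[cite: DupuyHilado2025, §1 (1.1), §3.6, §4.7] -/
theorem exists_deepAtPlace_not_cor312Of_of_weight_eq_one (hβ : weight F₀ v₀.1 = 1) (l : ℕ) (hl : l.Prime) (h5 : 5 ≤ l)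
    (σ : PlaceSection F₀ K) :
    ∃ (N : ℕ) (hN : 0 < N), ¬ (ThetaVolumeInput.deepAtPlace p v₀ l hl h5 N hN σ).Cor312Of := by
  refine exists_deepAtPlace_not_cor312Of_of_one_lt_coeff p v₀ l hl h5 σ ?_
  have h2 := two_le_half_pred_of_five_le h5
  have hgt := SplitBadPrime.sum_sq_gt_of_two_le ((l - 1) / 2) h2
  have hL : (0 : ℝ) < (((l - 1) / 2 : ℕ) : ℝ) := by exact_mod_cast (by omega : 0 < (l - 1) / 2)
  simp only [hβ, one_pow, mul_one]
  rw [one_div, ← div_eq_inv_mul, lt_div_iff₀ hL, one_mul]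
  exact hgt

/-- **`Pr(v₀) < 1` ⇒ TRUE at every depth for all LARGE `l`**: if at least two places lie over `p` (`n_{v₀} < [F₀:ℚ]`), there is `L`
such that for every prime `l ≥ 5` with `(l−1)/2 ≥ L`, every section `σ` and every depth `N`, `Cor312NonarchOf ∧ Cor312Of` hold for
`deepAtPlace p v₀ l N σ` (`LDHSplitBadPrimeLargeL.exists_lstar_bound_cor312Of_of_badMass_le` at `β = Pr(v₀)`, the bad mass at every prime
being `≤ Pr(v₀)`). Synthetic input; typed objects; no side taken. [claim: Mochizuki2012, status: disputed] [cite: DupuyHilado2025, §3.6] -/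
theorem exists_lstar_bound_cor312Of_deepAtPlace_of_weight_lt_one (hβ : weight F₀ v₀.1 < 1) :
    ∃ L : ℕ, ∀ (l : ℕ) (hl : l.Prime) (h5 : 5 ≤ l), L ≤ (l - 1) / 2 → ∀ (σ : PlaceSection F₀ K) (N : ℕ) (hN : 0 < N),
      (ThetaVolumeInput.deepAtPlace p v₀ l hl h5 N hN σ).Cor312NonarchOf ∧
        (ThetaVolumeInput.deepAtPlace p v₀ l hl h5 N hN σ).Cor312Of := by
  obtain ⟨L, hL⟩ := ThetaVolumeInput.exists_lstar_bound_cor312Of_of_badMass_le (F₀ := F₀) (K := K)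
    (weight_nonneg F₀ v₀.1) hβ
  refine ⟨L, fun l hl h5 hLl σ N hN => hL _ hLl fun p' _ => ?_⟩
  exact ThetaVolumeInput.deepAtPlace_badMass_le p v₀ l hl h5 N hN σ p'

/-- **The large-`l` PHASE of the one-bad-place family at `v₀`**: `Pr(v₀) = 1` ⇒ for every prime `l ≥ 5` and `σ` some depth is
FALSE; `Pr(v₀) < 1` ⇒ beyond some `L`, every prime `l` with `ℓ⋇ ≥ L`, every `σ`, every depth is TRUE. (`Pr(v₀) ≤ 1` always, so
these are the only cases.) Synthetic inputs; typed objects; no side taken. [claim: Mochizuki2012, status: disputed]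
[cite: DupuyHilado2025, §1 (1.1), §3.6, §4.7] -/
theorem deepAtPlace_phase :
    (weight F₀ v₀.1 = 1 → ∀ (l : ℕ) (hl : l.Prime) (h5 : 5 ≤ l) (σ : PlaceSection F₀ K),
        ∃ (N : ℕ) (hN : 0 < N), ¬ (ThetaVolumeInput.deepAtPlace p v₀ l hl h5 N hN σ).Cor312Of) ∧
      (weight F₀ v₀.1 < 1 → ∃ L : ℕ, ∀ (l : ℕ) (hl : l.Prime) (h5 : 5 ≤ l), L ≤ (l - 1) / 2 →
        ∀ (σ : PlaceSection F₀ K) (N : ℕ) (hN : 0 < N), (ThetaVolumeInput.deepAtPlace p v₀ l hl h5 N hN σ).Cor312Of) :=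
  ⟨fun hβ l hl h5 σ => exists_deepAtPlace_not_cor312Of_of_weight_eq_one p v₀ hβ l hl h5 σ,
    fun hβ => by
      obtain ⟨L, hL⟩ := exists_lstar_bound_cor312Of_deepAtPlace_of_weight_lt_one (K := K) p v₀ hβ
      exact ⟨L, fun l hl h5 hLl σ N hN => (hL l hl h5 hLl σ N hN).2⟩⟩

end Summit.ABC.IUTFork

end
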